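import Literature.MathematicalPhysics.QuantumLattice.GrassmannVertexPositions
import Literature.MathematicalPhysics.QuantumLattice.GrassmannLaplacianScriptBound
import Literature.MathematicalPhysics.QuantumLattice.GrassmannKernelsPresented
import Literature.Probability.LatticeModels.BattleFederbushPositiveCount
import HarnessLib

/-!
# The `L¹–L^∞` bound for the truncated expectation of kernel vertices in the Laplacian host

Topic `Literature/MathematicalPhysics/QuantumLattice`; the single-scale `n!`-free estimate of the
renormalisation group for fermions (Benfatto–Giuliani–Mastropietro 2006, (2.66)–(2.80); Gawȩdzki–Kupiainen
1985; Gentile–Mastropietro 2001, §4) in the Laplacian host `e^{Δ_C}` of this library: for `n` even kernel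
vertices `M_v = Σ_Y K_v(Y) ψ(Y)` supported on their clusters, the kernels of the truncated expectation
`𝓔ᵀ_C(M_0, …, M_{n-1})` (`ursellOf (convMoment C M) univ`) obey, one output label pinned at `w` and the others
summed,

`Σ_{W : W_i = w} ‖kernel_r 𝓔ᵀ (W)‖ ≤ (r!)⁻¹ N^{(r)} κ^{N - r - 2(n-1)} (∏_v ‖K_v‖_{1,∞}) λ^{-(n-1)} ∏_ℓ (1 + λ α m m'_ℓ)`

(`N = Σ m_v` fields, `N^{(r)}` the falling factorial, `κ` the Gram constant of the charged covariance, `α` a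
bound for the row and column sums of the norms of the type-restricted covariances `C|_ℓ` (for replica
covariances: the one-copy row sum), `m m'_ℓ` the product of the degrees of the two clusters of `ℓ`, any `λ > 0`): the tree formula (`GrassmannLaplacianTreeExpansion`), multilinearity
(`GrassmannMonomialFlatten`), the Gram bound per script and pattern (`GrassmannLaplacianScriptBound`), the label
sums by the tree-decay lemma (`GrassmannVertexPositions`, `KernelTreeDecay`), the pattern count
(`GrassmannPatternCounting`) and the positivity count of the scripts with their interpolation weights
(`BattleFederbushPositiveCount`).  No `n!`: the only factorially growing objects, the scripts, are summed against
their weights `∫ w_s ≤` (positivity).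

* `pairDeg`, `card_filter_lapPred_le`; `sum_kerProd_sum_patWeight_le` (one pattern), `sum_sum_norm_kernel_treeFactor_le`
  (one script), `norm_kernel_ursellOf_kernelVertex_le` (the tree formula read in kernels),
  **`sum_norm_kernel_ursellOf_kernelVertex_le`** (the bound).

Everything is proved; no named fact.

## Sources

G. Benfatto, A. Giuliani, V. Mastropietro, Ann. Henri Poincaré 7 (2006) 809–898, (2.66)–(2.80)
(`BenfattoGiulianiMastropietro2006`); K. Gawȩdzki, A. Kupiainen, Comm. Math. Phys. 102 (1985) 1–30
(`GawedzkiKupiainen1985GrossNeveu`); G. Gentile, V. Mastropietro, Phys. Rep. 352 (2001) 273–437, §4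
(`GentileMastropietro2001`).
-/

noncomputable section

namespace Literature.MathematicalPhysics.QuantumLattice

open GrassmannAlgebra Finset MvPolynomial Literature.RingTheory.MvPolynomial
open Literature.Probability.LatticeModels Literature.Probability.LatticeModels.BattleFederbush
open Literature.MeasureTheory.Integral
open scoped InnerProductSpace

variable {𝕜 : Type*} [RCLike 𝕜] {Γ : Type*} [Fintype Γ] [DecidableEq Γ] {n : ℕ}
variable (C : Matrix Γ Γ 𝕜) (cl : Γ → Fin n) {deg : Fin n → ℕ} (K : ∀ v : Fin n, (Fin (deg v) → Γ) → 𝕜)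

/-! ### Counting the consistent steps of a line -/

/-- The product of the degrees of the two clusters of a line. [folklore] -/
def pairDeg (deg : Fin n → ℕ) : Sym2 (Fin n) → ℕ :=
  Sym2.lift ⟨fun a b => deg a * deg b, fun _ _ => Nat.mul_comm _ _⟩

omit [RCLike 𝕜] [Fintype Γ] [DecidableEq Γ] in
/-- **The consistent Laplacian steps of the line `ℓ` number `≤ 2 m m'_ℓ`.** [folklore] -/
theorem card_filter_lapPred_le (S : Finset (Fin (∑ v, deg v))) (C' : Matrix Γ Γ 𝕜) (ℓ : Sym2 (Fin n)) :
    ((DelOp.stepSet S (DelOp.lap C' : DelOp Γ 𝕜)).filter fun pq => lapPred deg ℓ pq).card ≤ 2 * pairDeg deg ℓ := by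
  induction ℓ using Sym2.ind with
  | h a b =>
    rw [pairDeg, Sym2.lift_mk]
    refine le_trans (le_of_eq (congrArg card (filter_congr fun pq _ => by rw [lapPred, decide_eq_true_iff]))) ?_
    refine (DelOp.card_filter_stepSet_lap_le S C' (vert deg) a b).trans ?_
    rw [card_filter_vert, card_filter_vert]

omit [Fintype Γ] [DecidableEq Γ] in
/-- The shapes of the operations of a script do not depend on the output labels. [folklore] -/
theorem map_isLap_scriptOps {v : Fin n} {k r : ℕ} (W : Fin r → Γ) (s : Script v k) :
    (scriptOps C cl W s).map DelOp.isLap = List.replicate r false ++ List.replicate k true := by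
  rw [scriptOps, List.map_append, List.map_map, List.map_map, List.map_ofFn,
    show ((DelOp.isLap ∘ DelOp.ext) ∘ W) = fun _ : Fin r => false from rfl, List.ofFn_const,
    show (DelOp.isLap ∘ fun ℓ => (DelOp.lap (typeRestrict C cl ℓ) : DelOp Γ 𝕜)) = fun _ => true from rfl, List.map_const',
    List.length_reverse, Script.length_lines]

omit [Fintype Γ] [DecidableEq Γ] in
/-- The pattern set of a script does not depend on the output labels. [folklore] -/
theorem patSet_scriptOps_eq {v : Fin n} {k r : ℕ} (W W' : Fin r → Γ) (s : Script v k) (S : Finset (Fin (∑ v, deg v))) :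
    patSet (scriptOps C cl W s) S = patSet (scriptOps C cl W' s) S :=
  patSet_congr (by rw [map_isLap_scriptOps, map_isLap_scriptOps]) S

/-! ### One pattern: the label sums -/

/-- **The label sum of one pattern of one script** (output slot `i` pinned at `w`, tree rooted at `cl w`):
`Σ_Y ∏‖K‖ Σ_{W : W_i = w} weight(flat Y, ops_W(s), π) ≤ [π admissible] (α/2)^k ∏_u N_u`. [cite: BenfattoGiulianiMastropietro2006, proof of (2.77)] -/
theorem sum_kerProd_sum_patWeight_le (hK : ∀ v Yv, K v Yv ≠ 0 → ∀ j, cl (Yv j) = v) (Nv : Fin n → ℝ) (hN0 : ∀ u, 0 ≤ Nv u)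
    (hN : ∀ u (j : Fin (deg u)) (a : Γ), ∑ Yu ∈ univ.filter (fun Yu : Fin (deg u) → Γ => Yu j = a), ‖K u Yu‖ ≤ Nv u)
    {α : ℝ} (hα : 0 ≤ α) (hrow : ∀ ℓ X, ∑ Y, ‖typeRestrict C cl ℓ X Y‖ ≤ α) (hcol : ∀ ℓ Y, ∑ X, ‖typeRestrict C cl ℓ X Y‖ ≤ α)
    {w : Γ} {k : ℕ} (s : Script (cl w) k) (hs : s.Valid) (hcov : univ.image s.y = univ) {r : ℕ} (i : Fin r)
    (π : List (Fin (∑ v, deg v) × Fin (∑ v, deg v))) :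
    ∑ Ys : (∀ v, Fin (deg v) → Γ), (∏ u, ‖K u (Ys u)‖) *
        ∑ W ∈ univ.filter (fun W : Fin r → Γ => W i = w), patWeight (flat Ys) (scriptOps C cl W s) π ≤
      (if stepsOK (List.replicate r (fun _ => true) ++ s.lines.reverse.map (lapPred deg)) π then 1 else 0) *
        ((α / 2) ^ k * ∏ u, Nv u) := by
  set D := (α / 2) ^ k * ∏ u, Nv u with hD
  have hD0 : 0 ≤ D := mul_nonneg (pow_nonneg (by positivity) _) (prod_nonneg fun u _ => hN0 u)
  have hRHS0 : 0 ≤ (if stepsOK (List.replicate r (fun _ => true) ++ s.lines.reverse.map (lapPred deg)) π then (1 : ℝ) else 0) * D := by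
    split_ifs <;> simp [hD0]
  set laps : List (DelOp Γ 𝕜) := s.lines.reverse.map fun ℓ => DelOp.lap (typeRestrict C cl ℓ) with hlaps
  have h1 : ∀ (Ys : ∀ v, Fin (deg v) → Γ) (W : Fin r → Γ), patWeight (flat Ys) (scriptOps C cl W s) π =
      patWeight (flat Ys) ((List.ofFn W).map DelOp.ext : List (DelOp Γ 𝕜)) (π.take r) * patWeight (flat Ys) laps (π.drop r) := by
    intro Ys W
    rw [scriptOps, patWeight_append, List.length_map, List.length_ofFn]
  have hG0 : ∀ Ys : ∀ v, Fin (deg v) → Γ, 0 ≤ ∏ u, ‖K u (Ys u)‖ := fun Ys => prod_nonneg fun u _ => norm_nonneg _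
  -- too short patterns carry no weight
  by_cases hr : π.length < r
  · refine le_trans (le_of_eq (sum_eq_zero fun Ys _ => ?_)) hRHS0
    rw [sum_eq_zero fun W _ => ?_, mul_zero]
    rw [h1, patWeight_map_ext_eq_zero_of_lt _ W _ (by rw [List.length_take]; exact lt_of_le_of_lt (min_le_right _ _) hr), zero_mul]
  have hr' : r ≤ π.length := not_lt.1 hr
  have hi : (i : ℕ) < (π.take r).length := by rw [List.length_take, min_eq_left hr']; exact i.2
  set pq₀ := (π.take r)[(i : ℕ)]'hi with hpq₀
  have hget : (π.take r)[(i : ℕ)]? = some pq₀ := List.getElem?_eq_getElem hi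
  -- the output-label sum
  have h2 : ∀ Ys : ∀ v, Fin (deg v) → Γ, (∏ u, ‖K u (Ys u)‖) * ∑ W ∈ univ.filter (fun W : Fin r → Γ => W i = w),
      patWeight (flat Ys) (scriptOps C cl W s) π ≤
      (∏ u, ‖K u (Ys u)‖) * ((if flat Ys pq₀.1 = w then 1 else 0) * patWeight (flat Ys) laps (π.drop r)) := by
    intro Ys
    refine mul_le_mul_of_nonneg_left ?_ (hG0 Ys)
    simp only [h1]
    rw [← sum_mul]
    refine mul_le_mul_of_nonneg_right ?_ (patWeight_nonneg _ _ _)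
    have h := sum_filter_patWeight_map_ext_le (𝕜 := 𝕜) (flat Ys) i w (π.take r)
    rw [hget, Option.map_some] at h
    refine h.trans (le_of_eq ?_)
    by_cases ha : flat Ys pq₀.1 = w <;> simp [ha]
  refine (sum_le_sum fun Ys _ => h2 Ys).trans ?_
  -- reindex by position labellings and insert the consistency constraints
  have h3 : ∑ Ys : (∀ v, Fin (deg v) → Γ), (∏ u, ‖K u (Ys u)‖) * ((if flat Ys pq₀.1 = w then 1 else 0) * patWeight (flat Ys) laps (π.drop r)) =
      ∑ x : Fin (∑ v, deg v) → Γ, if vert deg pq₀.1 = cl w then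
        (if x pq₀.1 = w then kerProd K x * lapWt C cl deg s.lines.reverse (π.drop r) x else 0) else 0 := by
    refine Fintype.sum_equiv (flatEquiv deg) _ _ fun Ys => ?_
    rw [flatEquiv_apply, ← kerProd_flat, mul_left_comm, kerProd_mul_patWeight_laps C cl K hK, ← mul_left_comm, ← mul_assoc,
      kerProd_mul_ite_eq cl K hK]
    split_ifs <;> ring
  rw [h3]
  by_cases hv : vert deg pq₀.1 = cl w
  swap
  · simp only [hv, if_false, sum_const_zero]; exact hRHS0
  simp only [hv, if_true]
  rw [← sum_filter]
  by_cases hc : stepsOK (s.lines.reverse.map (lapPred deg)) (π.drop r) = true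
  · rw [stepsOK_append, List.length_replicate, stepsOK_replicate_true, hc, Bool.and_true,
      if_pos (by rw [decide_eq_true_iff, List.length_take, min_eq_left hr']), one_mul]
    exact sum_kerProd_mul_lapWt_le C cl K Nv hN0 hN hα hrow hcol s hs hcov (π.drop r) pq₀.1 hv w
  · refine le_trans (le_of_eq (sum_eq_zero fun x _ => ?_)) hRHS0
    rw [lapWt_eq C cl x _ _ (List.nodup_reverse.2 (Script.nodup_lines s hs)), if_neg hc, mul_zero]

/-! ### One script: the Gram bound summed over the labels -/

/-- **One script** (Benfatto–Giuliani–Mastropietro 2006, (2.77) for one anchored tree): with the output slot `i`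
pinned at `w` and the tree rooted at `cl w`,
`Σ_{W : W_i = w} Σ_Y ∏‖K‖ ‖kernel_r (treeFactor s ψ(flat Y)) (W)‖ ≤ (r!)⁻¹ N^{(r)} κ^{N-r-2k} (∏ N_u) (∏_{ℓ ∈ lines} α m m'_ℓ) ∫ w_s`.
[cite: BenfattoGiulianiMastropietro2006, (2.77)] -/
theorem sum_sum_norm_kernel_treeFactor_le {E : Type*} [NormedAddCommGroup E] [InnerProductSpace 𝕜 E]
    (q : Γ → Bool) (hC : ∀ X Y, q X = q Y → C X Y = 0) (f g : Γ → E) {κ : ℝ} (hκ : 0 ≤ κ)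
    (hf : ∀ X, q X = true → ‖f X‖ ≤ κ) (hg : ∀ Y, q Y = false → ‖g Y‖ ≤ κ)
    (hG : ∀ X Y, q X = true → q Y = false → contr 𝕜 C X Y = ⟪f X, g Y⟫_𝕜)
    (hK : ∀ v Yv, K v Yv ≠ 0 → ∀ j, cl (Yv j) = v) (Nv : Fin n → ℝ) (hN0 : ∀ u, 0 ≤ Nv u)
    (hN : ∀ u (j : Fin (deg u)) (a : Γ), ∑ Yu ∈ univ.filter (fun Yu : Fin (deg u) → Γ => Yu j = a), ‖K u Yu‖ ≤ Nv u)
    {α : ℝ} (hα : 0 ≤ α) (hrow : ∀ ℓ X, ∑ Y, ‖typeRestrict C cl ℓ X Y‖ ≤ α) (hcol : ∀ ℓ Y, ∑ X, ‖typeRestrict C cl ℓ X Y‖ ≤ α)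
    {w : Γ} {k : ℕ} (s : Script (cl w) k) (hs : s.Valid) (hcov : univ.image s.y = univ) {r : ℕ} (i : Fin r) :
    ∑ W ∈ univ.filter (fun W : Fin r → Γ => W i = w), ∑ Ys : (∀ v, Fin (deg v) → Γ), (∏ u, ‖K u (Ys u)‖) *
        ‖kernel 𝕜 (((Script.treeFactor (pairLap 𝕜 C cl) s : laplacianAlgebra 𝕜 C cl) : Module.End 𝕜 (GrassmannAlgebra 𝕜 Γ))
          (genProd 𝕜 (flat Ys))) r W‖ ≤
      ((((r.factorial : ℝ))⁻¹ * ((∑ v, deg v).descFactorial r : ℝ)) * κ ^ ((∑ v, deg v) - (r + 2 * k)) * ∏ u, Nv u) *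
        ((s.lines.map fun ℓ => α * (pairDeg deg ℓ : ℝ)).prod * cubeIntegral (Fin n) ℝ (s.weight ℝ)) := by
  set P := patSet (scriptOps C cl (fun _ : Fin r => w) s) (univ : Finset (Fin (∑ v, deg v))) with hP
  set Iw := cubeIntegral (Fin n) ℝ (s.weight ℝ) with hIw
  set c := ((r.factorial : ℝ))⁻¹ with hc
  set e := (∑ v, deg v) - (r + 2 * k) with he
  set D := (α / 2) ^ k * ∏ u, Nv u with hD
  set preds := List.replicate r (fun _ : Fin (∑ v, deg v) × Fin (∑ v, deg v) => true) ++ s.lines.reverse.map (lapPred deg) with hpreds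
  have hIw0 : 0 ≤ Iw := cubeIntegral_nonneg _ fun t ht => FermionicTree.eval_weight_nonneg s ht
  have hc0 : 0 ≤ c := inv_nonneg.2 (Nat.cast_nonneg _)
  have hD0 : 0 ≤ D := mul_nonneg (pow_nonneg (by positivity) _) (prod_nonneg fun u _ => hN0 u)
  have hG0 : ∀ Ys : ∀ v, Fin (deg v) → Γ, 0 ≤ ∏ u, ‖K u (Ys u)‖ := fun Ys => prod_nonneg fun u _ => norm_nonneg _
  -- the Gram bound per output slot and label family
  have h1 : ∀ (W : Fin r → Γ) (Ys : ∀ v, Fin (deg v) → Γ), (∏ u, ‖K u (Ys u)‖) *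
      ‖kernel 𝕜 (((Script.treeFactor (pairLap 𝕜 C cl) s : laplacianAlgebra 𝕜 C cl) : Module.End 𝕜 (GrassmannAlgebra 𝕜 Γ))
        (genProd 𝕜 (flat Ys))) r W‖ ≤
      ∑ π ∈ P, (c * κ ^ e * Iw) * ((∏ u, ‖K u (Ys u)‖) * patWeight (flat Ys) (scriptOps C cl W s) π) := by
    intro W Ys
    have h := norm_kernel_treeFactor_genProd_le C cl q hC f g hκ hf hg hG s hs (flat Ys) W
    rw [patSet_scriptOps_eq C cl W (fun _ => w) s, ← hP, ← hc, ← he, ← hIw] at h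
    refine (mul_le_mul_of_nonneg_left h (hG0 Ys)).trans (le_of_eq ?_)
    rw [mul_sum, sum_mul, mul_sum]
    exact sum_congr rfl fun π _ => by ring
  -- the admissible patterns and their count
  have hcount : ((P.filter fun π => stepsOK preds π).card : ℝ) ≤
      (((∑ v, deg v).descFactorial r * (s.lines.reverse.map fun ℓ => 2 * pairDeg deg ℓ).prod : ℕ) : ℝ) := by
    set L : List (DelOp Γ 𝕜 × (Fin (∑ v, deg v) × Fin (∑ v, deg v) → Bool) × (ℕ → ℕ)) :=
      ((List.ofFn fun _ : Fin r => w).map fun X => (DelOp.ext X, (fun _ => true), id)) ++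
        (s.lines.reverse.map fun ℓ => (DelOp.lap (typeRestrict C cl ℓ), lapPred deg ℓ, fun _ => 2 * pairDeg deg ℓ)) with hL
    have hfst : L.map Prod.fst = scriptOps C cl (fun _ : Fin r => w) s := by
      rw [hL, List.map_append, List.map_map, List.map_map, scriptOps]; rfl
    have hpred : L.map (fun x => x.2.1) = preds := by
      rw [hL, hpreds, List.map_append, List.map_map, List.map_map, List.map_ofFn]
      exact congrArg₂ _ (List.ofFn_const _ _) rfl
    have hbd : L.map (fun x => (x.1, x.2.2)) = ((List.ofFn fun _ : Fin r => w).map fun X => ((DelOp.ext X : DelOp Γ 𝕜), id)) ++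
        (s.lines.reverse.map fun ℓ => ((DelOp.lap (typeRestrict C cl ℓ) : DelOp Γ 𝕜), fun _ => 2 * pairDeg deg ℓ)) := by
      rw [hL, List.map_append, List.map_map, List.map_map]; rfl
    have hB : ∀ x ∈ L, ∀ S' : Finset (Fin (∑ v, deg v)), ((DelOp.stepSet S' x.1).filter fun pq => x.2.1 pq).card ≤ x.2.2 S'.card := by
      intro x hx S'
      rw [hL, List.mem_append, List.mem_map, List.mem_map] at hx
      rcases hx with ⟨X, -, rfl⟩ | ⟨ℓ, -, rfl⟩
      · rw [filter_true_of_mem fun _ _ => rfl, DelOp.card_stepSet_ext]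
        exact le_rfl
      · exact card_filter_lapPred_le S' _ ℓ
    have h := card_filter_patSet_le L hB univ
    rw [hfst, hpred, hbd, countBound_append, countBound_exts, countBound_consts, card_univ, Fintype.card_fin] at h
    exact_mod_cast h
  -- the per-line factors
  have hprod : (s.lines.map fun ℓ => α * (pairDeg deg ℓ : ℝ)).prod =
      (α / 2) ^ k * (((s.lines.reverse.map fun ℓ => 2 * pairDeg deg ℓ).prod : ℕ) : ℝ) := by
    rw [Nat.cast_list_prod, List.map_map, List.map_reverse, List.prod_reverse,
      show (fun ℓ => α * (pairDeg deg ℓ : ℝ)) = fun ℓ => (α / 2) * ((Nat.cast : ℕ → ℝ) ∘ fun ℓ => 2 * pairDeg deg ℓ) ℓ from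
        funext fun ℓ => by simp only [Function.comp_apply, Nat.cast_mul, Nat.cast_ofNat]; ring,
      List.prod_map_mul, List.map_const', List.prod_replicate, Script.length_lines]
  calc ∑ W ∈ univ.filter (fun W : Fin r → Γ => W i = w), ∑ Ys : (∀ v, Fin (deg v) → Γ), (∏ u, ‖K u (Ys u)‖) *
          ‖kernel 𝕜 (((Script.treeFactor (pairLap 𝕜 C cl) s : laplacianAlgebra 𝕜 C cl) : Module.End 𝕜 (GrassmannAlgebra 𝕜 Γ))
            (genProd 𝕜 (flat Ys))) r W‖
      ≤ ∑ W ∈ univ.filter (fun W : Fin r → Γ => W i = w), ∑ Ys : (∀ v, Fin (deg v) → Γ),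
          ∑ π ∈ P, (c * κ ^ e * Iw) * ((∏ u, ‖K u (Ys u)‖) * patWeight (flat Ys) (scriptOps C cl W s) π) :=
        sum_le_sum fun W _ => sum_le_sum fun Ys _ => h1 W Ys
    _ = (c * κ ^ e * Iw) * ∑ π ∈ P, ∑ Ys : (∀ v, Fin (deg v) → Γ), (∏ u, ‖K u (Ys u)‖) *
          ∑ W ∈ univ.filter (fun W : Fin r → Γ => W i = w), patWeight (flat Ys) (scriptOps C cl W s) π := by
        rw [mul_sum]
        calc ∑ W ∈ univ.filter (fun W : Fin r → Γ => W i = w), ∑ Ys : (∀ v, Fin (deg v) → Γ),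
                ∑ π ∈ P, (c * κ ^ e * Iw) * ((∏ u, ‖K u (Ys u)‖) * patWeight (flat Ys) (scriptOps C cl W s) π)
            = ∑ Ys : (∀ v, Fin (deg v) → Γ), ∑ W ∈ univ.filter (fun W : Fin r → Γ => W i = w),
                ∑ π ∈ P, (c * κ ^ e * Iw) * ((∏ u, ‖K u (Ys u)‖) * patWeight (flat Ys) (scriptOps C cl W s) π) := sum_comm
          _ = ∑ Ys : (∀ v, Fin (deg v) → Γ), ∑ π ∈ P, ∑ W ∈ univ.filter (fun W : Fin r → Γ => W i = w),
                (c * κ ^ e * Iw) * ((∏ u, ‖K u (Ys u)‖) * patWeight (flat Ys) (scriptOps C cl W s) π) :=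
              sum_congr rfl fun Ys _ => sum_comm
          _ = ∑ π ∈ P, ∑ Ys : (∀ v, Fin (deg v) → Γ), ∑ W ∈ univ.filter (fun W : Fin r → Γ => W i = w),
                (c * κ ^ e * Iw) * ((∏ u, ‖K u (Ys u)‖) * patWeight (flat Ys) (scriptOps C cl W s) π) := sum_comm
          _ = _ := sum_congr rfl fun π _ => by
              rw [mul_sum]
              refine sum_congr rfl fun Ys _ => ?_
              rw [mul_sum, mul_sum]
    _ ≤ (c * κ ^ e * Iw) * ∑ π ∈ P, (if stepsOK preds π then 1 else 0) * D :=
        mul_le_mul_of_nonneg_left (sum_le_sum fun π _ => sum_kerProd_sum_patWeight_le C cl K hK Nv hN0 hN hα hrow hcol s hs hcov i π)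
          (by positivity)
    _ = (c * κ ^ e * Iw) * (((P.filter fun π => stepsOK preds π).card : ℝ) * D) := by
        rw [← sum_mul, ← sum_boole]
    _ ≤ (c * κ ^ e * Iw) * ((((∑ v, deg v).descFactorial r * (s.lines.reverse.map fun ℓ => 2 * pairDeg deg ℓ).prod : ℕ) : ℝ) * D) :=
        mul_le_mul_of_nonneg_left (mul_le_mul_of_nonneg_right hcount hD0) (by positivity)
    _ = ((c * ((∑ v, deg v).descFactorial r : ℝ)) * κ ^ e * ∏ u, Nv u) *
          ((s.lines.map fun ℓ => α * (pairDeg deg ℓ : ℝ)).prod * Iw) := by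
        rw [hprod, hD, Nat.cast_mul]
        ring

/-! ### The tree formula read in kernels -/

/-- **The kernels of the truncated expectation, script by script**: for every root `v₀`,
`‖kernel_r 𝓔ᵀ (W)‖ ≤ Σ_Y ∏‖K‖ Σ_{valid scripts s at v₀ covering all vertices} ‖kernel_r (treeFactor s ψ(flat Y)) (W)‖`.
[cite: BenfattoGiulianiMastropietro2006, (2.66)-(2.70)] -/
theorem norm_kernel_ursellOf_kernelVertex_le (hm : ∀ v, Even (deg v)) (hK : ∀ v Yv, K v Yv ≠ 0 → ∀ j, cl (Yv j) = v)
    (v₀ : Fin n) (r : ℕ) (W : Fin r → Γ) :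
    ‖kernel 𝕜 ((ursellOf (convMoment 𝕜 C (kernelVertex 𝕜 hm K)) univ : evenPart 𝕜 Γ) : GrassmannAlgebra 𝕜 Γ) r W‖ ≤
      ∑ Ys : (∀ v, Fin (deg v) → Γ), (∏ u, ‖K u (Ys u)‖) * ∑ k ∈ range n, ∑ s : Script v₀ k,
        if s.Valid ∧ univ.image s.y = univ then
          ‖kernel 𝕜 (((Script.treeFactor (pairLap 𝕜 C cl) s : laplacianAlgebra 𝕜 C cl) : Module.End 𝕜 (GrassmannAlgebra 𝕜 Γ))
            (genProd 𝕜 (flat Ys))) r W‖ else 0 := by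
  rw [coe_ursellOf_convMoment_kernelVertex 𝕜 C cl hm K hK v₀, kernel_sum]
  refine (norm_sum_le _ _).trans (sum_le_sum fun Ys _ => ?_)
  rw [kernel_smul, norm_mul, norm_prod]
  refine mul_le_mul_of_nonneg_left ?_ (prod_nonneg fun u _ => norm_nonneg _)
  simp only [treeOp, Fintype.card_fin, AddSubmonoidClass.coe_finsetSum, LinearMap.sum_apply, kernel_sum]
  refine (norm_sum_le _ _).trans (sum_le_sum fun k _ => (norm_sum_le _ _).trans (sum_le_sum fun s _ => ?_))
  split_ifs with h
  · exact le_rfl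
  · simp

/-! ### The bound -/

/-- **The `L¹–L^∞` bound for the kernels of the truncated expectation of kernel vertices** (Benfatto–Giuliani–
Mastropietro 2006, (2.66)–(2.80); Gawȩdzki–Kupiainen 1985; Gentile–Mastropietro 2001, §4): for a charged
covariance `C` in Gram form on the mixed pairs with constant `κ` and row and column sums of `‖C|_ℓ‖` at most `α`,
even kernel vertices `M_v = Σ K_v ψ(·)` supported on their clusters with anchored `L¹` norms `≤ N_v`, and any
`λ > 0`: one output label pinned and the others summed,
`Σ_{W : W_i = w} ‖kernel_r 𝓔ᵀ_C(M_0,…,M_{n-1}) (W)‖ ≤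
  (r!)⁻¹ N^{(r)} κ^{N - r - 2(n-1)} (∏_v N_v) · λ^{-(n-1)} ∏_ℓ (1 + λ α m m'_ℓ)` — no `n!`.
[cite: BenfattoGiulianiMastropietro2006, (2.66)-(2.80)] -/
theorem sum_norm_kernel_ursellOf_kernelVertex_le {E : Type*} [NormedAddCommGroup E] [InnerProductSpace 𝕜 E]
    (q : Γ → Bool) (hC : ∀ X Y, q X = q Y → C X Y = 0) (f g : Γ → E) {κ : ℝ} (hκ : 0 ≤ κ)
    (hf : ∀ X, q X = true → ‖f X‖ ≤ κ) (hg : ∀ Y, q Y = false → ‖g Y‖ ≤ κ)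
    (hG : ∀ X Y, q X = true → q Y = false → contr 𝕜 C X Y = ⟪f X, g Y⟫_𝕜)
    (hm : ∀ v, Even (deg v)) (hK : ∀ v Yv, K v Yv ≠ 0 → ∀ j, cl (Yv j) = v) (Nv : Fin n → ℝ) (hN0 : ∀ u, 0 ≤ Nv u)
    (hN : ∀ u (j : Fin (deg u)) (a : Γ), ∑ Yu ∈ univ.filter (fun Yu : Fin (deg u) → Γ => Yu j = a), ‖K u Yu‖ ≤ Nv u)
    {α : ℝ} (hα : 0 ≤ α) (hrow : ∀ ℓ X, ∑ Y, ‖typeRestrict C cl ℓ X Y‖ ≤ α) (hcol : ∀ ℓ Y, ∑ X, ‖typeRestrict C cl ℓ X Y‖ ≤ α) {lam : ℝ} (hlam : 0 < lam)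
    {r : ℕ} (i : Fin r) (w : Γ) :
    ∑ W ∈ univ.filter (fun W : Fin r → Γ => W i = w),
        ‖kernel 𝕜 ((ursellOf (convMoment 𝕜 C (kernelVertex 𝕜 hm K)) univ : evenPart 𝕜 Γ) : GrassmannAlgebra 𝕜 Γ) r W‖ ≤
      ((((r.factorial : ℝ))⁻¹ * ((∑ v, deg v).descFactorial r : ℝ)) * κ ^ ((∑ v, deg v) - (r + 2 * (n - 1))) * ∏ u, Nv u) *
        ((lam⁻¹) ^ (n - 1) * ∏ ℓ : Sym2 (Fin n), (1 + lam * (α * (pairDeg deg ℓ : ℝ)))) := by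
  have hn : 0 < n := Fin.pos (cl w)
  set A := (((r.factorial : ℝ))⁻¹ * ((∑ v, deg v).descFactorial r : ℝ)) with hA
  have hA0 : 0 ≤ A := mul_nonneg (inv_nonneg.2 (Nat.cast_nonneg _)) (Nat.cast_nonneg _)
  set y : Sym2 (Fin n) → ℝ := fun ℓ => α * (pairDeg deg ℓ : ℝ) with hy
  have hy0 : ∀ ℓ, 0 ≤ y ℓ := fun ℓ => mul_nonneg hα (Nat.cast_nonneg _)
  have hNv : 0 ≤ ∏ u, Nv u := prod_nonneg fun u _ => hN0 u
  set Wset := univ.filter (fun W : Fin r → Γ => W i = w) with hWset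
  -- abbreviation for the script terms
  set T : ∀ k : ℕ, Script (cl w) k → (Fin r → Γ) → (∀ v, Fin (deg v) → Γ) → ℝ := fun k s W Ys =>
    ‖kernel 𝕜 (((Script.treeFactor (pairLap 𝕜 C cl) s : laplacianAlgebra 𝕜 C cl) : Module.End 𝕜 (GrassmannAlgebra 𝕜 Γ))
      (genProd 𝕜 (flat Ys))) r W‖ with hT
  calc ∑ W ∈ Wset, ‖kernel 𝕜 ((ursellOf (convMoment 𝕜 C (kernelVertex 𝕜 hm K)) univ : evenPart 𝕜 Γ) : GrassmannAlgebra 𝕜 Γ) r W‖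
      ≤ ∑ W ∈ Wset, ∑ Ys : (∀ v, Fin (deg v) → Γ), (∏ u, ‖K u (Ys u)‖) * ∑ k ∈ range n, ∑ s : Script (cl w) k,
          if s.Valid ∧ univ.image s.y = univ then T k s W Ys else 0 :=
        sum_le_sum fun W _ => norm_kernel_ursellOf_kernelVertex_le C cl K hm hK (cl w) r W
    _ = ∑ k ∈ range n, ∑ s : Script (cl w) k, ∑ W ∈ Wset, ∑ Ys : (∀ v, Fin (deg v) → Γ),
          (∏ u, ‖K u (Ys u)‖) * (if s.Valid ∧ univ.image s.y = univ then T k s W Ys else 0) := by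
        calc ∑ W ∈ Wset, ∑ Ys : (∀ v, Fin (deg v) → Γ), (∏ u, ‖K u (Ys u)‖) * ∑ k ∈ range n, ∑ s : Script (cl w) k,
                (if s.Valid ∧ univ.image s.y = univ then T k s W Ys else 0)
            = ∑ W ∈ Wset, ∑ Ys : (∀ v, Fin (deg v) → Γ), ∑ k ∈ range n, ∑ s : Script (cl w) k,
                (∏ u, ‖K u (Ys u)‖) * (if s.Valid ∧ univ.image s.y = univ then T k s W Ys else 0) :=
              sum_congr rfl fun W _ => sum_congr rfl fun Ys _ => by
                rw [mul_sum]
                exact sum_congr rfl fun k _ => mul_sum _ _ _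
          _ = ∑ W ∈ Wset, ∑ k ∈ range n, ∑ Ys : (∀ v, Fin (deg v) → Γ), ∑ s : Script (cl w) k,
                (∏ u, ‖K u (Ys u)‖) * (if s.Valid ∧ univ.image s.y = univ then T k s W Ys else 0) :=
              sum_congr rfl fun W _ => sum_comm
          _ = ∑ k ∈ range n, ∑ W ∈ Wset, ∑ Ys : (∀ v, Fin (deg v) → Γ), ∑ s : Script (cl w) k,
                (∏ u, ‖K u (Ys u)‖) * (if s.Valid ∧ univ.image s.y = univ then T k s W Ys else 0) := sum_comm
          _ = ∑ k ∈ range n, ∑ W ∈ Wset, ∑ s : Script (cl w) k, ∑ Ys : (∀ v, Fin (deg v) → Γ),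
                (∏ u, ‖K u (Ys u)‖) * (if s.Valid ∧ univ.image s.y = univ then T k s W Ys else 0) :=
              sum_congr rfl fun k _ => sum_congr rfl fun W _ => sum_comm
          _ = _ := sum_congr rfl fun k _ => sum_comm
    _ ≤ ∑ k ∈ range n, ∑ s : Script (cl w) k, (if s.Valid ∧ univ.image s.y = univ then
          (A * κ ^ ((∑ v, deg v) - (r + 2 * k)) * ∏ u, Nv u) * ((s.lines.map y).prod * cubeIntegral (Fin n) ℝ (s.weight ℝ)) else 0) := by
        refine sum_le_sum fun k _ => sum_le_sum fun s _ => ?_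
        split_ifs with h
        · exact sum_sum_norm_kernel_treeFactor_le C cl K q hC f g hκ hf hg hG hK Nv hN0 hN hα hrow hcol s h.1 h.2 i
        · simp
    _ = ∑ s : Script (cl w) (n - 1), (if s.Valid ∧ univ.image s.y = univ then
          (A * κ ^ ((∑ v, deg v) - (r + 2 * (n - 1))) * ∏ u, Nv u) * ((s.lines.map y).prod * cubeIntegral (Fin n) ℝ (s.weight ℝ)) else 0) := by
        rw [sum_eq_single (n - 1)]
        · intro k _ hk
          refine sum_eq_zero fun s _ => if_neg ?_
          rintro ⟨hs, hcov⟩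
          have h := Script.card_image_y s hs
          rw [hcov, card_univ, Fintype.card_fin] at h
          omega
        · intro h
          exact absurd (mem_range.2 (by omega)) h
    _ ≤ (A * κ ^ ((∑ v, deg v) - (r + 2 * (n - 1))) * ∏ u, Nv u) * ∑ s : Script (cl w) (n - 1),
          (if s.Valid then (s.lines.map y).prod * cubeIntegral (Fin n) ℝ (s.weight ℝ) else 0) := by
        rw [mul_sum]
        refine sum_le_sum fun s _ => ?_
        have h0 := Script.prod_mul_weight_nonneg s y hy0
        by_cases hv : s.Valid
        · by_cases hc : univ.image s.y = univ
          · simp [hv, hc]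
          · simp only [hv, hc, and_false, if_false, if_true]
            rw [if_pos hv] at h0
            exact mul_nonneg (mul_nonneg (mul_nonneg hA0 (pow_nonneg hκ _)) hNv) h0
        · simp [hv]
    _ ≤ (A * κ ^ ((∑ v, deg v) - (r + 2 * (n - 1))) * ∏ u, Nv u) * ((lam⁻¹) ^ (n - 1) * ∏ ℓ : Sym2 (Fin n), (1 + lam * y ℓ)) :=
        mul_le_mul_of_nonneg_left (sum_prod_mul_weight_le_of_scale y hy0 (cl w) hlam (by rw [Fintype.card_fin]; omega))
          (mul_nonneg (mul_nonneg hA0 (pow_nonneg hκ _)) hNv)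

end Literature.MathematicalPhysics.QuantumLattice
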